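import Literature.Topology.FourManifolds.LefschetzBaseRegular
import Literature.Topology.FourManifolds.DiffeotopyExtension
import Literature.Topology.FourManifolds.InverseFunctionTheorem
import HarnessLib

/-!
# N1 ▸ `node_N1_move` ▸ (c₁) THE FREE SLICE MOVE: ambient isotopies of `∂ Base g` extend to ambient
# isotopies of `Base g`
(wave 8, brick of stub `stub_M2geo` = node N1 of NF4 ▸ `node_N1_move_of_pieces (HC1) …` ▸ `HC1` ▸ hypothesis
`HISO` of `piece_c1_of_pieces` (`…SliceMoveAssembly.lean`), last step of its route (design v3, J5-F2/§3);
line `modp-braid-orbits`, crux `ConvexBisection.AcyclicBisectionExists`, item stmt-SmoothPoincare4-10508;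
worker J5, lead c5; registered sub-goal `helper_exists_ambientIsotopy_extension_bBase`)

The iso piece of `HC1` produces an ambient isotopy of `Base g` carrying one boundary loop onto another; its
natural construction lives on the closed boundary `3`-manifold `(bBase g).carrier` (flows of cut-off seam
fields).  This file supplies the passage to the `4`-manifold: **every ambient isotopy `F` of
`(bBase g).carrier` is the boundary trace of an ambient isotopy `G` of `Base g`**,
`G_t (incl v) = incl (F_t v)` for all `t` — the tree's diffeotopy extension over a collar
(`BoundaryData.exists_diffeotopy_comp_incl_eq_of_compactSpace`, `DiffeotopyExtension.lean`, with the collar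
theorem `CollarTheorem.lean`), after converting `F` to a diffeotopy (`AmbientIsotopy.toDiffeotopy`: the
boundary is boundaryless, `InverseFunctionTheorem.lean`) and the extension back
(`Diffeotopy.toAmbientIsotopy`).  The same statement for an abstract compact `X` with a boundary datum is
the cited tree theorem itself (used by the core, design v3 §1 (v)).
Everything is proved; no definitions, no named facts, no `sorry`.  References: A. A. Kosinski,
*Differential Manifolds* (1993), VI §7 [Kosinski1993]; M. W. Hirsch, *Differential Topology* (1976), Ch. 8
§1 [HirschDT1976].
-/

noncomputable section

set_option linter.dupNamespace false

open scoped Manifold ContDiff Topology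
open Set Function

namespace Summit.SmoothPoincare4.SmoothPoincare4.Theorems.AcyclicBisectionExists.ModpBraidOrbits

open Literature.Topology.FourManifolds Literature.Topology.FourManifolds.LefschetzBase

/-- **Sub-goal `helper_exists_ambientIsotopy_extension_bBase`** (fully qualified): every ambient isotopy
of the boundary `3`-manifold of `Base g` is the boundary trace of an ambient isotopy of `Base g`.
[cite: Kosinski1993, VI §7 proof of (7.2)] -/
theorem helper_exists_ambientIsotopy_extension_bBase : ∀ (g : ℕ) (F : Literature.Topology.FourManifolds.AmbientIsotopy (𝓡 3) (Literature.Topology.FourManifolds.LefschetzBase.bBase g).carrier), ∃ G : Literature.Topology.FourManifolds.AmbientIsotopy (𝓡∂ 4) (Literature.Topology.FourManifolds.LefschetzBase.Base g), ∀ (t : ℝ) (v : (Literature.Topology.FourManifolds.LefschetzBase.bBase g).carrier), G.toFun t ((Literature.Topology.FourManifolds.LefschetzBase.bBase g).incl v) = (Literature.Topology.FourManifolds.LefschetzBase.bBase g).incl (F.toFun t v) := by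
  intro g F
  obtain ⟨G, hG⟩ :=
    BoundaryData.exists_diffeotopy_comp_incl_eq_of_compactSpace 2 (bBase g) F.toDiffeotopy
  refine ⟨G.toAmbientIsotopy, fun t v => ?_⟩
  have h := congrFun (hG t) v
  simp only [Function.comp_apply, AmbientIsotopy.toDiffeotopy_toFun] at h
  rw [Diffeotopy.toAmbientIsotopy_toFun]
  exact h

/-- The time-`1` form: the stage `F 1` of a boundary ambient isotopy is the boundary trace of the stage
`G 1` of an ambient isotopy of `Base g`; in particular a boundary loop `incl ∘ γ` is carried to
`incl ∘ (F 1 ∘ γ)`. [cite: Kosinski1993, VI §7 proof of (7.2)] -/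
theorem exists_ambientIsotopy_extension_comp {g : ℕ} (F : AmbientIsotopy (𝓡 3) (bBase g).carrier)
    {ι : Type*} (γ : ι → (bBase g).carrier) :
    ∃ G : AmbientIsotopy (𝓡∂ 4) (Base g), ∀ (t : ℝ) (i : ι),
      G.toFun t ((bBase g).incl (γ i)) = (bBase g).incl (F.toFun t (γ i)) := by
  obtain ⟨G, hG⟩ := helper_exists_ambientIsotopy_extension_bBase g F
  exact ⟨G, fun t i => hG t (γ i)⟩

end Summit.SmoothPoincare4.SmoothPoincare4.Theorems.AcyclicBisectionExists.ModpBraidOrbits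

end
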